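import Literature.Analysis.Matrix.CoerciveCombesThomas
import Literature.Analysis.Matrix.LocalFloorWeightedCoercivity

/-!
# Stub D2′ `stub_leastSquaresCombesThomas` of line `determinant-tilt` (crux `SpectralDefectExtinction.ExtinctionBuildsQCD`,
# item stmt-QuantumFields-18064) — Combes–Thomas for the least-squares local inverse

Let `dist` be an `ℕ`-valued pseudo-metric on a finite index type `n`, `A : Matrix n n ℂ` a RANGE-ONE matrix
(`A i j ≠ 0 → dist i j ≤ 1`) whose absolute off-diagonal row and column sums are `≤ h`, `B` a set of indices on which
`A` is COERCIVE at level `τ ∈ (0,1]` (`τ² Σ|v|² ≤ Σ|Av|²` for every `v` supported in `B`), and `θ ≥ 0` a rate with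
`h(e^θ − 1) ≤ τ/4`.  With the coordinate projection `P = diag(1_B)` and `M = P Aᴴ A P + (1 − P)`, the matrix `M` is
invertible and `|M⁻¹ᵢⱼ| ≤ (16/(7τ²)) e^{−θ dist(i,j)}`: the decay RATE is proportional to the coercivity LEVEL `τ`
(first order), not to the spectral gap `τ²` of the second-order operator `P Aᴴ A P`.

Proof (Combes–Thomas with the square-root trick, [CombesThomas1973]; [AizenmanWarzel2015, §10.3]).  Fix a column
`j₀` and the weights `d_k = e^{θ dist(k,j₀)}`.  For every `x` put `p = P x` (the truncation of `x` to `B`).  Since `P`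
is a coordinate projection, `Σ_k d_k² conj(x_k) (Mx)_k = Σ_k d_k² conj(p_k) (AᴴA p)_k + Σ_{k ∉ B} d_k² |x_k|²`, and the
first term is the Combes–Thomas/Agmon weighted form of `AᴴA` at a vector supported in `B`, which the tree's LOCAL-FLOOR
weighted coercivity `Literature.Analysis.Matrix.weighted_coercive_of_localFloor` (floor `F = τ²` on `B`, `μ = 0`,
`η = h(e^θ − 1) ≤ τ/4`, so `t² − 2ηt − η² ≥ τ² − τ²/2 − τ²/16 = 7τ²/16` for `t ≥ τ`) bounds below by
`(7τ²/16) Σ_k d_k² |p_k|²`.  As `7τ²/16 ≤ 1`, altogether `(7τ²/16) Σ_k d_k²|x_k|² ≤ Re Σ_k d_k² conj(x_k) (Mx)_k`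
(`lsct_weighted_coercive`).  This weighted coercivity gives injectivity of `M` (so `IsUnit M.det`) and, on the column
`x = M⁻¹ e_{j₀}` (where `d_{j₀} = 1`), `(7τ²/16) S ≤ Re x_{j₀} ≤ √S` with `S = Σ d_k²|x_k|²`, whence
`d_i |x_i| ≤ √S ≤ 16/(7τ²)` — exactly as in `Literature.Analysis.Matrix.quadratic_combes_thomas`.

References (prose): Combes–Thomas, Comm. Math. Phys. 34 (1973) 251; Aizenman–Warzel, *Random Operators*, GSM 168
(2015), §10.3; Chulaevsky–Suhov (2014), Thm 2.3.3.
-/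

namespace Summit.QuantumFields.QCD.Cruxes.ExtinctionBuildsQCD.DeterminantTilt

open scoped BigOperators Matrix
open Filter MeasureTheory Matrix

/-- **Weighted coercivity of the least-squares matrix `M = P Aᴴ A P + (1 − P)`** (the Combes–Thomas conjugation,
unfolded).  Under the hypotheses of `stub_leastSquaresCombesThomas`, for every column index `j₀` and every `x`, with
the weights `d_k = e^{θ dist(k,j₀)}`:
`(7τ²/16) Σ_k d_k² |x_k|² ≤ Re Σ_k d_k² conj(x_k) (M x)_k`.
Proof: split `x = p + (x − p)` with `p = P x` supported in `B`; the form splits as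
`Σ_k d_k² conj(p_k) (AᴴA p)_k + Σ_{k ∉ B} d_k²|x_k|²`, and the first term is bounded below by
`Literature.Analysis.Matrix.weighted_coercive_of_localFloor` (local floor `τ²` on `B`, `μ = 0`, `γ = 7τ²/16`).
[folklore] -/
theorem lsct_weighted_coercive {n : Type} [Fintype n] [DecidableEq n] (dist : n → n → ℕ)
    (hds : ∀ i j, dist i j = dist j i) (hdt : ∀ i j l, dist i l ≤ dist i j + dist j l)
    (A : Matrix n n ℂ) (hrange : ∀ i j, A i j ≠ 0 → dist i j ≤ 1) (h : ℝ)
    (hrow : ∀ i, ∑ j ∈ Finset.univ.filter (fun j => dist i j ≠ 0), ‖A i j‖ ≤ h)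
    (hcol : ∀ j, ∑ i ∈ Finset.univ.filter (fun i => dist i j ≠ 0), ‖A i j‖ ≤ h)
    (B : Finset n) (τ θ : ℝ) (hτ : 0 < τ) (hτ1 : τ ≤ 1) (hθ : 0 ≤ θ)
    (hη : h * (Real.exp θ - 1) ≤ τ / 4)
    (hfloor : ∀ v : n → ℂ, (∀ i, i ∉ B → v i = 0) →
      τ ^ 2 * ∑ i, ‖v i‖ ^ 2 ≤ ∑ i, ‖(A *ᵥ v) i‖ ^ 2)
    (P M : Matrix n n ℂ) (hP : P = Matrix.diagonal (fun i => if i ∈ B then (1 : ℂ) else 0))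
    (hM : M = P * Aᴴ * A * P + (1 - P)) (j₀ : n) (x : n → ℂ) :
    7 * τ ^ 2 / 16 * ∑ k, Real.exp (θ * dist k j₀) ^ 2 * ‖x k‖ ^ 2 ≤
      (star (fun k => ((Real.exp (θ * dist k j₀) ^ 2 : ℝ) : ℂ) * x k) ⬝ᵥ (M *ᵥ x)).re := by
  -- the truncation `p = P x` of `x` to `B`
  obtain ⟨p, hp⟩ : ∃ p : n → ℂ, p = fun k => if k ∈ B then x k else 0 := ⟨_, rfl⟩
  have hPv : ∀ w : n → ℂ, P *ᵥ w = fun k => if k ∈ B then w k else 0 := by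
    intro w
    ext k
    rw [hP, Matrix.mulVec_diagonal]
    split_ifs <;> simp
  have hPx : P *ᵥ x = p := by rw [hPv, hp]
  have hpB : ∀ i, p i ≠ 0 → i ∈ B := by
    intro i hi
    by_contra hiB
    exact hi (by simp [hp, hiB])
  have hpk : ∀ k, p k = if k ∈ B then x k else 0 := fun k => by rw [hp]
  -- `M x = P (AᴴA p) + (x - p)`, coordinatewise
  have hMx : ∀ k, (M *ᵥ x) k = if k ∈ B then ((Aᴴ * A) *ᵥ p) k else x k := by
    have h1 : M *ᵥ x = P *ᵥ ((Aᴴ * A) *ᵥ p) + (x - p) := by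
      rw [hM, Matrix.add_mulVec, Matrix.sub_mulVec, Matrix.one_mulVec, ← Matrix.mulVec_mulVec,
        hPx, Matrix.mul_assoc, ← Matrix.mulVec_mulVec]
    intro k
    rw [h1, Pi.add_apply, Pi.sub_apply, hPv]
    by_cases hk : k ∈ B
    · simp [hk, hpk k]
    · simp [hk, hpk k]
  -- the tree's local-floor weighted coercivity, applied to `p`
  have hh0 : 0 ≤ h := (Finset.sum_nonneg fun j _ => norm_nonneg _).trans (hrow j₀)
  have hexp0 : 0 ≤ Real.exp θ - 1 := by linarith [Real.add_one_le_exp θ]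
  have hη0 : 0 ≤ h * (Real.exp θ - 1) := mul_nonneg hh0 hexp0
  have hcoer : ∀ t : ℝ, Real.sqrt (τ ^ 2) ≤ t →
      7 * τ ^ 2 / 16 ≤
        t ^ 2 - 2 * (h * (Real.exp θ - 1)) * t - (h * (Real.exp θ - 1)) ^ 2 + 0 := by
    intro t ht
    rw [Real.sqrt_sq hτ.le] at ht
    nlinarith [mul_nonneg (sub_nonneg.2 ht)
        (by linarith : (0 : ℝ) ≤ t + τ - 2 * (h * (Real.exp θ - 1))),
      mul_nonneg (by linarith : (0 : ℝ) ≤ τ / 4 - h * (Real.exp θ - 1))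
        (by linarith : (0 : ℝ) ≤ 9 * τ / 4 + h * (Real.exp θ - 1))]
  have hlit : 7 * τ ^ 2 / 16 * ∑ k, Real.exp (θ * dist k j₀) ^ 2 * ‖p k‖ ^ 2 ≤
      (star (fun k => ((Real.exp (θ * dist k j₀) ^ 2 : ℝ) : ℂ) * p k) ⬝ᵥ ((Aᴴ * A) *ᵥ p)).re := by
    have h1 := Literature.Analysis.Matrix.weighted_coercive_of_localFloor dist A hrange h hrow hcol
      (fun k => (dist k j₀ : ℝ))
      (fun i j => Literature.Analysis.Matrix.abs_natDist_sub_natDist_le dist hds hdt i j j₀)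
      (fun i => i ∈ B) (τ ^ 2) 0 θ (7 * τ ^ 2 / 16) hθ
      (fun w hw => hfloor w fun i hiB => not_not.mp fun hwi => hiB (hw i hwi)) hcoer p hpB
    simpa only [Complex.ofReal_zero, zero_smul, add_zero] using h1
  -- splitting of the weighted norm and of the form along `B`
  have hsplit : ∑ k, Real.exp (θ * dist k j₀) ^ 2 * ‖x k‖ ^ 2 =
      ∑ k, Real.exp (θ * dist k j₀) ^ 2 * ‖p k‖ ^ 2 +
        ∑ k, (if k ∈ B then 0 else Real.exp (θ * dist k j₀) ^ 2 * ‖x k‖ ^ 2) := by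
    rw [← Finset.sum_add_distrib]
    refine Finset.sum_congr rfl fun k _ => ?_
    by_cases hk : k ∈ B
    · simp [hk, hpk k]
    · simp [hk, hpk k]
  have key : ∀ (r : ℝ) (z : ℂ), star ((r : ℂ) * z) * z = ((r * ‖z‖ ^ 2 : ℝ) : ℂ) := by
    intro r z
    rw [star_mul', Complex.star_def, Complex.conj_ofReal, mul_assoc, Complex.conj_mul']
    push_cast
    ring
  have hform : star (fun k => ((Real.exp (θ * dist k j₀) ^ 2 : ℝ) : ℂ) * x k) ⬝ᵥ (M *ᵥ x) =
      star (fun k => ((Real.exp (θ * dist k j₀) ^ 2 : ℝ) : ℂ) * p k) ⬝ᵥ ((Aᴴ * A) *ᵥ p) +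
        ((∑ k, (if k ∈ B then 0 else Real.exp (θ * dist k j₀) ^ 2 * ‖x k‖ ^ 2) : ℝ) : ℂ) := by
    simp only [dotProduct, Pi.star_apply]
    rw [Complex.ofReal_sum, ← Finset.sum_add_distrib]
    refine Finset.sum_congr rfl fun k _ => ?_
    rw [hMx k, hpk k]
    by_cases hk : k ∈ B
    · rw [if_pos hk, if_pos hk, if_pos hk, Complex.ofReal_zero, add_zero]
    · rw [if_neg hk, if_neg hk, if_neg hk, mul_zero, star_zero, zero_mul, zero_add, key]
  have hout0 : 0 ≤ ∑ k, (if k ∈ B then 0 else Real.exp (θ * dist k j₀) ^ 2 * ‖x k‖ ^ 2) :=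
    Finset.sum_nonneg fun k _ => by split_ifs <;> positivity
  have hγ1 : 7 * τ ^ 2 / 16 ≤ 1 := by nlinarith
  rw [hform, Complex.add_re, Complex.ofReal_re, hsplit, mul_add]
  have := mul_le_of_le_one_left hout0 hγ1
  linarith

/-- **Stub D2′ (`stub_leastSquaresCombesThomas`) — COMBES–THOMAS FOR THE LEAST-SQUARES LOCAL INVERSE at the rate of the
COERCIVITY LEVEL.** Let `dist` be an `ℕ`-valued pseudo-metric on a finite index type, `A` a range-one matrix
(`A i j ≠ 0 → dist i j ≤ 1`) with absolute off-diagonal row and column sums `≤ h`, `B` a set of indices on which `A` is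
COERCIVE at level `τ ∈ (0,1]`: `τ²‖v‖² ≤ ‖A v‖²` for every `v` supported in `B`, and `θ ≥ 0` with `h(e^θ − 1) ≤ τ/4`.
Put `P := diag(1_B)` and `M := P Aᴴ A P + (1 − P)`.  Then `M` is invertible and
`‖(M⁻¹) i j‖ ≤ (16/(7τ²)) e^{−θ dist(i,j)}` — the rate is proportional to `τ` (first order), NOT to the spectral gap
`τ²` of the second-order operator `P Aᴴ A P`.  Proof: the weighted coercivity `lsct_weighted_coercive`
(`(7τ²/16) Σ d_k²|x_k|² ≤ Re Σ d_k² conj(x_k)(Mx)_k`, `d_k = e^{θ dist(k,j)}`) gives injectivity, and on the column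
`x = M⁻¹ e_j` (`d_j = 1`) it gives `(7τ²/16) S ≤ Re x_j ≤ √S`, `S = Σ d_k²|x_k|²`, so `d_i|x_i| ≤ √S ≤ 16/(7τ²)`.
Model: `Literature.Analysis.Matrix.quadratic_combes_thomas` / `coercive_combes_thomas`.
[cite: AizenmanWarzel2015, §10.3 (Combes–Thomas estimate)] -/
theorem stub_leastSquaresCombesThomas :
    ∀ {n : Type} [Fintype n] [DecidableEq n] (dist : n → n → ℕ), (∀ i, dist i i = 0) → (∀ i j, dist i j = dist j i) →
      (∀ i j l, dist i l ≤ dist i j + dist j l) →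
      ∀ (A : Matrix n n ℂ), (∀ i j, A i j ≠ 0 → dist i j ≤ 1) →
      ∀ (h : ℝ), (∀ i, ∑ j ∈ Finset.univ.filter (fun j => dist i j ≠ 0), ‖A i j‖ ≤ h) →
        (∀ j, ∑ i ∈ Finset.univ.filter (fun i => dist i j ≠ 0), ‖A i j‖ ≤ h) →
      ∀ (B : Finset n) (τ θ : ℝ), 0 < τ → τ ≤ 1 → 0 ≤ θ → h * (Real.exp θ - 1) ≤ τ / 4 →
      (∀ v : n → ℂ, (∀ i, i ∉ B → v i = 0) → τ ^ 2 * ∑ i, ‖v i‖ ^ 2 ≤ ∑ i, ‖(A *ᵥ v) i‖ ^ 2) →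
      ∀ (P M : Matrix n n ℂ), P = Matrix.diagonal (fun i => if i ∈ B then (1 : ℂ) else 0) →
        M = P * Aᴴ * A * P + (1 - P) →
        IsUnit M.det ∧ ∀ i j, ‖M⁻¹ i j‖ ≤ 16 / (7 * τ ^ 2) * Real.exp (-(θ * dist i j)) := by
  intro n _ _ dist hd0 hds hdt A hrange h hrow hcol B τ θ hτ hτ1 hθ hη hfloor P M hP hM
  -- the weighted coercivity of `M` at rate `γ = 7τ²/16`
  have core : ∀ (j₀ : n) (x : n → ℂ),
      7 * τ ^ 2 / 16 * ∑ k, Real.exp (θ * dist k j₀) ^ 2 * ‖x k‖ ^ 2 ≤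
        (star (fun k => ((Real.exp (θ * dist k j₀) ^ 2 : ℝ) : ℂ) * x k) ⬝ᵥ (M *ᵥ x)).re :=
    fun j₀ x => lsct_weighted_coercive dist hds hdt A hrange h hrow hcol B τ θ hτ hτ1 hθ hη hfloor
      P M hP hM j₀ x
  have hτ0 : τ ≠ 0 := hτ.ne'
  set γ : ℝ := 7 * τ ^ 2 / 16 with hγdef
  have hγ : 0 < γ := by positivity
  have hγC : γ * (16 / (7 * τ ^ 2)) = 1 := by
    rw [hγdef]
    field_simp
  -- the diagonal weight is `1` and dominates: `|x_{j₀}|² ≤ Σ_k d_k² |x_k|²`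
  have hdiag : ∀ (j₀ : n) (x : n → ℂ),
      ‖x j₀‖ ^ 2 ≤ ∑ k, Real.exp (θ * dist k j₀) ^ 2 * ‖x k‖ ^ 2 := by
    intro j₀ x
    have := Finset.single_le_sum (f := fun k => Real.exp (θ * dist k j₀) ^ 2 * ‖x k‖ ^ 2)
      (fun k _ => by positivity) (Finset.mem_univ j₀)
    simpa only [hd0, Nat.cast_zero, mul_zero, Real.exp_zero, one_pow, one_mul] using this
  -- (1) `M` is injective, hence invertible
  have hdet : IsUnit M.det := by
    rw [isUnit_iff_ne_zero, Ne, ← Matrix.exists_mulVec_eq_zero_iff]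
    rintro ⟨x, hx, hKx⟩
    obtain ⟨j₀, hj₀⟩ := Function.ne_iff.mp hx
    have h1 := core j₀ x
    rw [hKx, dotProduct_zero, Complex.zero_re] at h1
    have h2 := hdiag j₀ x
    have h3 : 0 < ‖x j₀‖ ^ 2 := by positivity
    nlinarith
  refine ⟨hdet, fun i j => ?_⟩
  -- (2) the column `j` of `M⁻¹`
  obtain ⟨x, hx⟩ : ∃ x : n → ℂ, x = M⁻¹ *ᵥ Pi.single j 1 := ⟨_, rfl⟩
  have hxK : ∀ k, x k = M⁻¹ k j := fun k => by
    rw [hx, Matrix.mulVec_single_one, Matrix.col_apply]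
  have hKx : M *ᵥ x = Pi.single j 1 := by
    rw [hx, Matrix.mulVec_mulVec, Matrix.mul_nonsing_inv _ hdet, Matrix.one_mulVec]
  rw [← hxK i]
  obtain ⟨S, hS⟩ : ∃ S : ℝ, S = ∑ k, Real.exp (θ * dist k j) ^ 2 * ‖x k‖ ^ 2 := ⟨_, rfl⟩
  have h1 := core j x
  rw [hKx, dotProduct_single_one, ← hS] at h1
  simp only [Pi.star_apply, hd0, Nat.cast_zero, mul_zero, Real.exp_zero, one_pow,
    Complex.ofReal_one, one_mul, Complex.star_def, Complex.conj_re] at h1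
  have hS0 : 0 ≤ S := by rw [hS]; exact Finset.sum_nonneg fun k _ => by positivity
  have hjS : ‖x j‖ ^ 2 ≤ S := by rw [hS]; exact hdiag j x
  have hiS : Real.exp (θ * dist i j) ^ 2 * ‖x i‖ ^ 2 ≤ S := by
    rw [hS]
    exact Finset.single_le_sum (f := fun k => Real.exp (θ * dist k j) ^ 2 * ‖x k‖ ^ 2)
      (fun k _ => by positivity) (Finset.mem_univ i)
  -- `γ S ≤ Re x_j ≤ |x_j| ≤ √S`, hence `γ² S ≤ 1`
  have h2 : γ * S ≤ ‖x j‖ := h1.trans (Complex.re_le_norm _)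
  have hγS : 0 ≤ γ * S := mul_nonneg hγ.le hS0
  have h3 : (γ * S) ^ 2 ≤ S := (pow_le_pow_left₀ hγS h2 2).trans hjS
  have h5 : γ ^ 2 * S ≤ 1 := by
    by_cases hS00 : S = 0
    · rw [hS00, mul_zero]; exact zero_le_one
    · have hSpos : 0 < S := lt_of_le_of_ne hS0 (Ne.symm hS00)
      have h6 : γ ^ 2 * S * S ≤ 1 * S := by nlinarith
      exact le_of_mul_le_mul_right h6 hSpos
  have h4 : (Real.exp (θ * dist i j) * ‖x i‖) ^ 2 ≤ (16 / (7 * τ ^ 2)) ^ 2 := by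
    rw [mul_pow]
    refine hiS.trans ?_
    calc S = (16 / (7 * τ ^ 2)) ^ 2 * (γ ^ 2 * S) := by
          rw [show (16 / (7 * τ ^ 2)) ^ 2 * (γ ^ 2 * S) = (γ * (16 / (7 * τ ^ 2))) ^ 2 * S by ring,
            hγC, one_pow, one_mul]
      _ ≤ (16 / (7 * τ ^ 2)) ^ 2 * 1 := mul_le_mul_of_nonneg_left h5 (sq_nonneg _)
      _ = (16 / (7 * τ ^ 2)) ^ 2 := mul_one _
  have h7 : Real.exp (θ * dist i j) * ‖x i‖ ≤ 16 / (7 * τ ^ 2) :=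
    (pow_le_pow_iff_left₀ (by positivity) (by positivity) two_ne_zero).mp h4
  rw [Real.exp_neg, ← div_eq_mul_inv, le_div_iff₀ (Real.exp_pos _), mul_comm]
  exact h7

end Summit.QuantumFields.QCD.Cruxes.ExtinctionBuildsQCD.DeterminantTilt
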